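import Literature.Geometry.Lorentzian.CauchyDevelopmentIsometryClasses
import HarnessLib

/-!
# Re-basing a Cauchy development on another of its Cauchy hypersurfaces, and
# Choquet-Bruhat–Geroch 1969, Corollary 1: the MGHD of `S` is the MGHD of every Cauchy surface `S'` in it

Y. Choquet-Bruhat, R. Geroch, *Global aspects of the Cauchy problem in general relativity*,
Comm. Math. Phys. **14** (1969) 329–335, p. 334 (held, `paper:doi-10-1007-bf01645389`, p. 6 of the
scan), immediately after the proof of Theorem 3 (existence and uniqueness of the maximal development):

> We shall henceforth use the term "maximal" in the sence of Theorem 3, i.e., a development `M` of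
> `S` is maximal if `M` is an extension of every other development of `S`. … Furthermore, it
> follows from the theorem that maximality is a property only of the solution `M`, not of the
> particular choice of initial data from which `M` has arisen:
> **Corollary 1.** *Let `M` be the maximal development of `S`, and let `S'` be a Cauchy surface in
> `M`. Then `M` is the maximal development of `S'`.*
> … **Corollary 2.** *Let `S` and `S'` be Cauchy surfaces in a spacetime. Then, considered as
> initial data sets, `S` and `S'` have isometric maximal developments.*

(developments: p. 330, "a development of `S` … a solution of Einstein's equations in which `S` is
a Cauchy surface", with the data induced on `S`; extension: an isometric imbedding commuting with
the imbeddings of `S`).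

## What this file provides

* **`CauchyDevelopment.reslice`, `VacuumCauchyDevelopment.reslice`** (definitions): the SAME
  spacetime `(M, g, τ)` of a (vacuum) Cauchy development `𝒟` of data `D` on `X`, re-based on
  another Cauchy hypersurface — a smooth embedding `ι' : X' → M` with future unit normal `ν'`,
  inducing the data `D' = (ι'^* g, K_{ν'})` on `X'`, whose image is a Cauchy hypersurface of
  `(M, g, τ)` — as a (vacuum) Cauchy development of `D'`.  This is the tree's packaging of
  "`S'` a Cauchy surface in `M`, considered as an initial data set" (the unbundled future-slice
  binder block of the Final-State-Conjecture routes, e.g. `CascadeSingleExit` of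
  `Summits/FinalStateConjecture/…/RootDecompHoleCountCells.lean`, is exactly the argument list of
  `reslice`); `reslice_toSpacetime : (𝒟.reslice …).toSpacetime = 𝒟.toSpacetime` and its
  companions hold by `rfl`, and `reslice_self` (re-basing on the original slice returns `𝒟`).
* **`choquetBruhat_geroch_mghd_reslice`** — Corollary 1 as a NAMED FACT (D-0014) over the repaired
  development structure (`VacuumCauchyDevelopment`, `IsMaximal`, `LorentzianMetric.IsCauchyHypersurface`,
  `CauchyDevelopment.lean`), dimension `3 + 1` and universe `Type` as in the existence fact
  `choquetBruhat_geroch_exists_mghd_cauchy` (`CauchyProblemMGHDExistence.lean`): *if `𝒟` is a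
  maximal vacuum Cauchy development of `D` and `ι'(X')` is a Cauchy hypersurface of `𝒟` with induced
  data `D'`, then `𝒟.reslice ι' …` is a maximal vacuum Cauchy development of `D'`* — every vacuum
  Cauchy development of `D'` embeds into `𝒟` compatibly with `ι'`.
* Proved consequences (`namespace choquetBruhat_geroch_mghd_reslice`): `embedsInto_reslice` (the
  unfolded form), `isIsometricTo_reslice` (every maximal vacuum Cauchy development of the induced
  data `D'` is isometric, as a development of `D'`, to the re-based `𝒟` — uniqueness of the MGHD,
  `VacuumCauchyDevelopment.isIsometricTo_of_isMaximal` of `CauchyProblemCauchy.lean`, whose rigidity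
  hypothesis `hrig` is kept explicit here and is discharged in the tree by
  `DataEmbedding.eq_id_of_comp_embed_eq'` (`MGHDUniqueness.lean`; not imported: at the time of
  writing the hub carries no `.olean` for its import `IsometricImmersionRigidity`)),
  `isMaximal_reslice_reslice` (iterating: a Cauchy hypersurface of the re-based development again
  yields a maximal development — "maximality is a property only of the solution `M`").

## Why a named fact, and the road to a discharge

The printed proof is "it follows from the theorem": with `M' :=` the maximal development of `S'`
(Theorem 3), `M` is a development of `S'`, so `M` embeds into `M'` by an extension `ψ`; `ψ(S)` is a
Cauchy surface of `M'` (a purely causal lemma: an endless timelike curve of `M'` meets `S'` exactly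
once, its maximal sub-arcs inside the open set `ψ(M)` are endless timelike curves of `ψ(M) ≅ M`,
each meeting both `ψ(S)` and `S'` exactly once); hence `M'`, with `ψ ∘ ι`, is a development of `S`,
so it embeds into the maximal `M` over `S`; the composite self-embedding of `M` fixes `ι(X)` and is
the identity (rigidity — PROVED in the tree, `DataEmbedding.eq_id_of_comp_embed_eq'`,
`MGHDUniqueness.lean`), whence
`M ≅ M'` over `S'` and `M` is maximal for `S'`.  In the tree the existence theorem is itself the named
fact `choquetBruhat_geroch_exists_mghd_cauchy`, and two further ingredients have no carrier yet:
(i) the causal lemma "a Cauchy hypersurface of an open globally hyperbolic sub-spacetime containing a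
Cauchy hypersurface of the ambient spacetime is a Cauchy hypersurface of the ambient spacetime" over
`LorentzianMetric.IsCauchyHypersurface`, and (ii) transport of a `CauchyDevelopment` structure along
a time-orientation preserving isometric open embedding (`ψ ∘ ι` induces the same data; the tree has
the special case of open SUBSETS, `CauchyDevelopment.restrict`, `CauchyDevelopmentRestrict.lean`).
Given (i), (ii) the fact reduces to `choquetBruhat_geroch_exists_mghd_cauchy`; it is recorded here as
a fact so that the Final-State-Conjecture decomposition cell (items stmt-FinalStateConjecture-27603/27604:
"an unbundled future slice IS a Cauchy development `D'` with the same spacetime") can consume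
Corollary 1 by name now.  Corollary 2 is NOT vendored (it needs, besides Theorem 3, the same causal
lemma (i) to see the second surface as a Cauchy surface of the maximal development).

## References

* Y. Choquet-Bruhat, R. Geroch, Comm. Math. Phys. **14** (1969) 329–335: p. 330 (developments,
  extensions), Thm. 3 (p. 332), Corollary 1 and Corollary 2 (p. 334). [ChoquetBruhatGeroch1969CMP]
* H. Ringström, *The Cauchy Problem in General Relativity*, EMS 2009, Def. 16.1–16.5, Thm. 16.6.
  [Ringstrom2009]
* J. Sbierski, Ann. Henri Poincaré **17** (2016) 301–329 = arXiv:1309.7591, §2 (GHD, extension,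
  MGHD), Thm. 2.8. [Sbierski2016AHP]
* B. O'Neill, *Semi-Riemannian geometry*, Academic Press 1983, Ch. 14, Def. 14.28 (Cauchy
  hypersurface).
-/

noncomputable section

open Function Set Manifold
open scoped Manifold ContDiff Topology

universe u

namespace Literature.Geometry.Lorentzian

variable {n : ℕ} {X : Type u} [TopologicalSpace X] [ChartedSpace (EuclideanSpace ℝ (Fin n)) X]
  [IsManifold (𝓡 n) ∞ X] [ConnectedSpace X] {D : InitialDataSet (𝓡 n) X}
  {X' : Type u} [TopologicalSpace X'] [ChartedSpace (EuclideanSpace ℝ (Fin n)) X']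
  [IsManifold (𝓡 n) ∞ X'] [ConnectedSpace X'] {D' : InitialDataSet (𝓡 n) X'}

/-! ### Re-basing a development on another Cauchy hypersurface -/

namespace CauchyDevelopment

/-- **The same spacetime, re-based on another Cauchy hypersurface** ("let `S'` be a Cauchy surface in
`M` …, considered as an initial data set"): for a Cauchy development `𝒟 = (M, g, τ, ι, ν)` of `D`, a
smooth embedding `ι' : X' → M` with future unit normal `ν'` whose induced metric and second
fundamental form are the data `D' = (h', k')` on `X'` and whose image `ι'(X')` is a Cauchy
hypersurface of `(M, g, τ)`, the Cauchy development `(M, g, τ, ι', ν')` of `D'`.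
Choquet-Bruhat–Geroch, CMP 14 (1969), p. 330 and Corollary 1 (p. 334); Ringström 2009, Def. 16.2.
[cite: ChoquetBruhatGeroch1969CMP, p. 330 and Corollary 1 (p. 334)] -/
def reslice (𝒟 : CauchyDevelopment D) (ι' : X' → 𝒟.carrier) (ν' : NormalField (𝓡 (n + 1)) ι')
    (hι' : Manifold.IsSmoothEmbedding (𝓡 n) (𝓡 (n + 1)) ∞ ι')
    (hν' : 𝒟.metric.IsFutureUnitNormal (𝓡 n) 𝒟.timeOrientation ι' ν')
    (hh : ∀ y : X', pullbackBilin (I := 𝓡 (n + 1)) (I' := 𝓡 n) ι' 𝒟.metric.val y = D'.h.inner y)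
    (hk : ∀ [𝒟.metric.toPseudoRiemannianMetric.HasLeviCivita] (y : X'),
      𝒟.metric.toPseudoRiemannianMetric.secondFundamentalForm (𝓡 n) ι' ν' y = D'.kBilin y)
    (hC : 𝒟.metric.IsCauchyHypersurface 𝒟.timeOrientation (range ι')) :
    CauchyDevelopment D' where
  toSpacetime := 𝒟.toSpacetime
  embed := ι'
  isSmoothEmbedding := hι'
  normal := ν'
  isFutureUnitNormal := hν'
  induced_h := hh
  induced_k := hk
  isCauchyHypersurface := hC

section

variable (𝒟 : CauchyDevelopment D) (ι' : X' → 𝒟.carrier) (ν' : NormalField (𝓡 (n + 1)) ι')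
  (hι' : Manifold.IsSmoothEmbedding (𝓡 n) (𝓡 (n + 1)) ∞ ι')
  (hν' : 𝒟.metric.IsFutureUnitNormal (𝓡 n) 𝒟.timeOrientation ι' ν')
  (hh : ∀ y : X', pullbackBilin (I := 𝓡 (n + 1)) (I' := 𝓡 n) ι' 𝒟.metric.val y = D'.h.inner y)
  (hk : ∀ [𝒟.metric.toPseudoRiemannianMetric.HasLeviCivita] (y : X'),
    𝒟.metric.toPseudoRiemannianMetric.secondFundamentalForm (𝓡 n) ι' ν' y = D'.kBilin y)
  (hC : 𝒟.metric.IsCauchyHypersurface 𝒟.timeOrientation (range ι'))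

/-- The re-based development has the same spacetime `(M, g, τ)` (by `rfl`).
Choquet-Bruhat–Geroch 1969, Corollary 1. [cite: ChoquetBruhatGeroch1969CMP, Corollary 1 (p. 334)] -/
@[simp] theorem reslice_toSpacetime : (𝒟.reslice ι' ν' hι' hν' hh hk hC).toSpacetime = 𝒟.toSpacetime := rfl

/-- … the same carrier `M`. [cite: ChoquetBruhatGeroch1969CMP, Corollary 1 (p. 334)] -/
theorem reslice_carrier : (𝒟.reslice ι' ν' hι' hν' hh hk hC).carrier = 𝒟.carrier := rfl

/-- … the same metric `g`. [cite: ChoquetBruhatGeroch1969CMP, Corollary 1 (p. 334)] -/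
theorem reslice_metric : (𝒟.reslice ι' ν' hι' hν' hh hk hC).metric = 𝒟.metric := rfl

/-- … the same time orientation `τ`. [cite: ChoquetBruhatGeroch1969CMP, Corollary 1 (p. 334)] -/
theorem reslice_timeOrientation :
    (𝒟.reslice ι' ν' hι' hν' hh hk hC).timeOrientation = 𝒟.timeOrientation := rfl

/-- … and the new slice `ι'` as its embedding. [cite: ChoquetBruhatGeroch1969CMP, Corollary 1 (p. 334)] -/
@[simp] theorem reslice_embed : (𝒟.reslice ι' ν' hι' hν' hh hk hC).embed = ι' := rfl

/-- … with normal `ν'`. [cite: ChoquetBruhatGeroch1969CMP, Corollary 1 (p. 334)] -/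
@[simp] theorem reslice_normal : (𝒟.reslice ι' ν' hι' hν' hh hk hC).normal = ν' := rfl

end

/-- Re-basing on the ORIGINAL slice `(ι, ν)` returns `𝒟` itself. [cite: ChoquetBruhatGeroch1969CMP, Corollary 1 (p. 334)] -/
theorem reslice_self (𝒟 : CauchyDevelopment D) :
    𝒟.reslice 𝒟.embed 𝒟.normal 𝒟.isSmoothEmbedding 𝒟.isFutureUnitNormal 𝒟.induced_h 𝒟.induced_k
      𝒟.isCauchyHypersurface = 𝒟 := by
  cases 𝒟
  rfl

end CauchyDevelopment

namespace VacuumCauchyDevelopment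

/-- **The same VACUUM spacetime, re-based on another Cauchy hypersurface**: `CauchyDevelopment.reslice`
with the field equations `Ric(g) = 0` carried over (same metric). Choquet-Bruhat–Geroch, CMP 14
(1969), p. 330 and Corollary 1 (p. 334). [cite: ChoquetBruhatGeroch1969CMP, p. 330 and Corollary 1 (p. 334)] -/
def reslice (𝒟 : VacuumCauchyDevelopment D) (ι' : X' → 𝒟.carrier) (ν' : NormalField (𝓡 (n + 1)) ι')
    (hι' : Manifold.IsSmoothEmbedding (𝓡 n) (𝓡 (n + 1)) ∞ ι')
    (hν' : 𝒟.metric.IsFutureUnitNormal (𝓡 n) 𝒟.timeOrientation ι' ν')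
    (hh : ∀ y : X', pullbackBilin (I := 𝓡 (n + 1)) (I' := 𝓡 n) ι' 𝒟.metric.val y = D'.h.inner y)
    (hk : ∀ [𝒟.metric.toPseudoRiemannianMetric.HasLeviCivita] (y : X'),
      𝒟.metric.toPseudoRiemannianMetric.secondFundamentalForm (𝓡 n) ι' ν' y = D'.kBilin y)
    (hC : 𝒟.metric.IsCauchyHypersurface 𝒟.timeOrientation (range ι')) :
    VacuumCauchyDevelopment D' where
  toCauchyDevelopment := 𝒟.toCauchyDevelopment.reslice ι' ν' hι' hν' hh hk hC
  isRicciFlat := by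
    intro inst
    haveI : 𝒟.metric.toPseudoRiemannianMetric.HasLeviCivita := inst
    exact 𝒟.isRicciFlat

section

variable (𝒟 : VacuumCauchyDevelopment D) (ι' : X' → 𝒟.carrier) (ν' : NormalField (𝓡 (n + 1)) ι')
  (hι' : Manifold.IsSmoothEmbedding (𝓡 n) (𝓡 (n + 1)) ∞ ι')
  (hν' : 𝒟.metric.IsFutureUnitNormal (𝓡 n) 𝒟.timeOrientation ι' ν')
  (hh : ∀ y : X', pullbackBilin (I := 𝓡 (n + 1)) (I' := 𝓡 n) ι' 𝒟.metric.val y = D'.h.inner y)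
  (hk : ∀ [𝒟.metric.toPseudoRiemannianMetric.HasLeviCivita] (y : X'),
    𝒟.metric.toPseudoRiemannianMetric.secondFundamentalForm (𝓡 n) ι' ν' y = D'.kBilin y)
  (hC : 𝒟.metric.IsCauchyHypersurface 𝒟.timeOrientation (range ι'))

/-- The underlying Cauchy development of the re-based vacuum development is the re-based Cauchy
development (by `rfl`). [cite: ChoquetBruhatGeroch1969CMP, Corollary 1 (p. 334)] -/
theorem reslice_toCauchyDevelopment :
    (𝒟.reslice ι' ν' hι' hν' hh hk hC).toCauchyDevelopment =
      𝒟.toCauchyDevelopment.reslice ι' ν' hι' hν' hh hk hC := rfl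

/-- Same spacetime (by `rfl`). [cite: ChoquetBruhatGeroch1969CMP, Corollary 1 (p. 334)] -/
@[simp] theorem reslice_toSpacetime : (𝒟.reslice ι' ν' hι' hν' hh hk hC).toSpacetime = 𝒟.toSpacetime := rfl

/-- Same carrier. [cite: ChoquetBruhatGeroch1969CMP, Corollary 1 (p. 334)] -/
theorem reslice_carrier : (𝒟.reslice ι' ν' hι' hν' hh hk hC).carrier = 𝒟.carrier := rfl

/-- Same metric. [cite: ChoquetBruhatGeroch1969CMP, Corollary 1 (p. 334)] -/
theorem reslice_metric : (𝒟.reslice ι' ν' hι' hν' hh hk hC).metric = 𝒟.metric := rfl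

/-- Same time orientation. [cite: ChoquetBruhatGeroch1969CMP, Corollary 1 (p. 334)] -/
theorem reslice_timeOrientation :
    (𝒟.reslice ι' ν' hι' hν' hh hk hC).timeOrientation = 𝒟.timeOrientation := rfl

/-- The new slice is the embedding. [cite: ChoquetBruhatGeroch1969CMP, Corollary 1 (p. 334)] -/
@[simp] theorem reslice_embed : (𝒟.reslice ι' ν' hι' hν' hh hk hC).embed = ι' := rfl

/-- The new normal. [cite: ChoquetBruhatGeroch1969CMP, Corollary 1 (p. 334)] -/
@[simp] theorem reslice_normal : (𝒟.reslice ι' ν' hι' hν' hh hk hC).normal = ν' := rfl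

end

/-- Re-basing on the original slice returns `𝒟`. [cite: ChoquetBruhatGeroch1969CMP, Corollary 1 (p. 334)] -/
theorem reslice_self (𝒟 : VacuumCauchyDevelopment D) :
    𝒟.reslice 𝒟.embed 𝒟.normal 𝒟.isSmoothEmbedding 𝒟.isFutureUnitNormal 𝒟.induced_h 𝒟.induced_k
      𝒟.isCauchyHypersurface = 𝒟 := by
  cases 𝒟
  rfl

end VacuumCauchyDevelopment

/-! ### Choquet-Bruhat–Geroch 1969, Corollary 1 (named fact) -/

/-- **Choquet-Bruhat–Geroch 1969, Corollary 1 (the MGHD of `S` is the MGHD of every Cauchy surface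
in it), over the repaired structure `VacuumCauchyDevelopment`.**  "Let `M` be the maximal development
of `S`, and let `S'` be a Cauchy surface in `M`. Then `M` is the maximal development of `S'`."
Formally: for every connected smooth `3`-manifold `X`, data `D` on `X` and MAXIMAL vacuum Cauchy
development `𝒟 = (M, g, τ, ι, ν)` of `D` (`VacuumCauchyDevelopment.IsMaximal`: every vacuum Cauchy
development of `D` embeds isometrically into `𝒟` over `ι`), and for every smooth embedding
`ι' : X' → M` of a connected smooth `3`-manifold `X'` with future unit normal `ν'`, inducing the data
`D' = (ι'^* g, K_{ν'})` and with `ι'(X')` a Cauchy hypersurface of `(M, g, τ)`, the re-based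
development `𝒟.reslice ι' ν' …` — the same spacetime as a vacuum Cauchy development of `D'` — is
maximal: every vacuum Cauchy development of `D'` embeds isometrically into `M` over `ι'`.  No
restriction of `ι'(X')` to the future of `ι(X)` (none in the source).  Printed proof: "it follows
from the theorem" [Thm. 3] — see the module docstring for the route and for the two tree-side gaps
(a causal lemma on Cauchy hypersurfaces of globally hyperbolic open sub-spacetimes; transport of a
development structure along an isometric open embedding) that keep this a named fact (D-0014); the
uniqueness-of-the-MGHD step it uses is proved in the tree (`MGHDUniqueness.lean`).  Users take
`(h : choquetBruhat_geroch_mghd_reslice)`; wanted by the FSC decomposition items stmt-…-27603/27604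
(future-slice transport). [cite: ChoquetBruhatGeroch1969CMP, Corollary 1 (p. 334)]
[cite: Ringstrom2009, Def. 16.5 and Thm. 16.6] [cite: Sbierski2016AHP, §2] -/
def choquetBruhat_geroch_mghd_reslice : Prop :=
  ∀ (X : Type) [TopologicalSpace X] [ChartedSpace (EuclideanSpace ℝ (Fin 3)) X]
    [IsManifold (𝓡 3) ∞ X] [ConnectedSpace X] (D : InitialDataSet (𝓡 3) X)
    (𝒟 : VacuumCauchyDevelopment D), 𝒟.IsMaximal →
    ∀ (X' : Type) [TopologicalSpace X'] [ChartedSpace (EuclideanSpace ℝ (Fin 3)) X']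
      [IsManifold (𝓡 3) ∞ X'] [ConnectedSpace X'] (D' : InitialDataSet (𝓡 3) X')
      (ι' : X' → 𝒟.carrier) (ν' : NormalField (𝓡 4) ι')
      (hι' : Manifold.IsSmoothEmbedding (𝓡 3) (𝓡 4) ∞ ι')
      (hν' : 𝒟.metric.IsFutureUnitNormal (𝓡 3) 𝒟.timeOrientation ι' ν')
      (hh : ∀ y : X', pullbackBilin (I := 𝓡 4) (I' := 𝓡 3) ι' 𝒟.metric.val y = D'.h.inner y)
      (hk : ∀ [𝒟.metric.toPseudoRiemannianMetric.HasLeviCivita] (y : X'),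
        𝒟.metric.toPseudoRiemannianMetric.secondFundamentalForm (𝓡 3) ι' ν' y = D'.kBilin y)
      (hC : 𝒟.metric.IsCauchyHypersurface 𝒟.timeOrientation (range ι')),
      (𝒟.reslice ι' ν' hι' hν' hh hk hC).IsMaximal

/-! ### Consequences -/

namespace choquetBruhat_geroch_mghd_reslice

variable {Y : Type} [TopologicalSpace Y] [ChartedSpace (EuclideanSpace ℝ (Fin 3)) Y] [IsManifold (𝓡 3) ∞ Y]
  [ConnectedSpace Y] {E : InitialDataSet (𝓡 3) Y}
  {Y' : Type} [TopologicalSpace Y'] [ChartedSpace (EuclideanSpace ℝ (Fin 3)) Y'] [IsManifold (𝓡 3) ∞ Y']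
  [ConnectedSpace Y'] {E' : InitialDataSet (𝓡 3) Y'}
  (h : choquetBruhat_geroch_mghd_reslice) {𝒟 : VacuumCauchyDevelopment E} (h𝒟 : 𝒟.IsMaximal)
  (ι' : Y' → 𝒟.carrier) (ν' : NormalField (𝓡 4) ι')
  (hι' : Manifold.IsSmoothEmbedding (𝓡 3) (𝓡 4) ∞ ι')
  (hν' : 𝒟.metric.IsFutureUnitNormal (𝓡 3) 𝒟.timeOrientation ι' ν')
  (hh : ∀ y : Y', pullbackBilin (I := 𝓡 4) (I' := 𝓡 3) ι' 𝒟.metric.val y = E'.h.inner y)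
  (hk : ∀ [𝒟.metric.toPseudoRiemannianMetric.HasLeviCivita] (y : Y'),
    𝒟.metric.toPseudoRiemannianMetric.secondFundamentalForm (𝓡 3) ι' ν' y = E'.kBilin y)
  (hC : 𝒟.metric.IsCauchyHypersurface 𝒟.timeOrientation (range ι'))
include h h𝒟

/-- **Corollary 1, applied**: the re-based development is maximal. [cite: ChoquetBruhatGeroch1969CMP, Corollary 1 (p. 334)] -/
theorem isMaximal_reslice : (𝒟.reslice ι' ν' hι' hν' hh hk hC).IsMaximal :=
  h Y E 𝒟 h𝒟 Y' E' ι' ν' hι' hν' hh hk hC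

/-- **Future-slice transport, unfolded**: under Corollary 1, every vacuum Cauchy development `𝒟''` of
the data `E'` induced on a Cauchy hypersurface `ι'(Y')` of a maximal vacuum Cauchy development `𝒟`
embeds — smoothly, isometrically, as an open set, preserving time orientation, and compatibly with
the embeddings of `Y'` — into the spacetime of `𝒟`. [cite: ChoquetBruhatGeroch1969CMP, Corollary 1 (p. 334)] -/
theorem embedsInto_reslice (𝒟'' : VacuumCauchyDevelopment E') :
    𝒟''.toCauchyDevelopment.EmbedsInto (𝒟.reslice ι' ν' hι' hν' hh hk hC).toCauchyDevelopment :=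
  isMaximal_reslice h h𝒟 ι' ν' hι' hν' hh hk hC 𝒟''

/-- **Uniqueness form**: under Corollary 1, every MAXIMAL vacuum Cauchy development `𝒟''` of the induced
data `E'` is isometric, as a development of `E'` (a time-orientation preserving isometric diffeomorphism
commuting with the embeddings of `Y'`), to the re-based `𝒟` — uniqueness of the MGHD
(`VacuumCauchyDevelopment.isIsometricTo_of_isMaximal`, `CauchyProblemCauchy.lean`), with its rigidity
hypothesis `hrig` on `𝒟''` kept explicit (discharged in the tree by `DataEmbedding.eq_id_of_comp_embed_eq'`,
`MGHDUniqueness.lean`). Choquet-Bruhat–Geroch 1969, Thm. 3 (uniqueness clause) with Corollary 1.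
[cite: ChoquetBruhatGeroch1969CMP, Thm. 3 (p. 332) and Corollary 1 (p. 334)] -/
theorem isIsometricTo_reslice {𝒟'' : VacuumCauchyDevelopment E'}
    (hrig : ∀ φ : 𝒟''.carrier → 𝒟''.carrier,
      𝒟''.metric.IsIsometricImmersion 𝒟''.metric.toPseudoRiemannianMetric φ →
        𝒟''.timeOrientation.PreservesTimeOrientation φ 𝒟''.timeOrientation →
          φ ∘ 𝒟''.embed = 𝒟''.embed → φ = id)
    (h'' : 𝒟''.IsMaximal) :
    𝒟''.toCauchyDevelopment.IsIsometricTo (𝒟.reslice ι' ν' hι' hν' hh hk hC).toCauchyDevelopment :=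
  VacuumCauchyDevelopment.isIsometricTo_of_isMaximal hrig h'' (isMaximal_reslice h h𝒟 ι' ν' hι' hν' hh hk hC)

omit h𝒟 in
/-- **"Maximality is a property only of the solution `M`"**: iterating Corollary 1, a Cauchy
hypersurface `ι''(Y'')` of the re-based development (i.e. of the same spacetime) again carries a
maximal development, whichever slice `𝒟` was maximal for. [cite: ChoquetBruhatGeroch1969CMP, Corollary 1 and the sentence before it (p. 334)] -/
theorem isMaximal_reslice_reslice (h𝒟 : 𝒟.IsMaximal)
    {Y'' : Type} [TopologicalSpace Y''] [ChartedSpace (EuclideanSpace ℝ (Fin 3)) Y''] [IsManifold (𝓡 3) ∞ Y'']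
    [ConnectedSpace Y''] {E'' : InitialDataSet (𝓡 3) Y''}
    (ι'' : Y'' → 𝒟.carrier) (ν'' : NormalField (𝓡 4) ι'')
    (hι'' : Manifold.IsSmoothEmbedding (𝓡 3) (𝓡 4) ∞ ι'')
    (hν'' : 𝒟.metric.IsFutureUnitNormal (𝓡 3) 𝒟.timeOrientation ι'' ν'')
    (hh'' : ∀ y : Y'', pullbackBilin (I := 𝓡 4) (I' := 𝓡 3) ι'' 𝒟.metric.val y = E''.h.inner y)
    (hk'' : ∀ [𝒟.metric.toPseudoRiemannianMetric.HasLeviCivita] (y : Y''),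
      𝒟.metric.toPseudoRiemannianMetric.secondFundamentalForm (𝓡 3) ι'' ν'' y = E''.kBilin y)
    (hC'' : 𝒟.metric.IsCauchyHypersurface 𝒟.timeOrientation (range ι'')) :
    ((𝒟.reslice ι' ν' hι' hν' hh hk hC).reslice ι'' ν'' hι'' hν'' hh'' @hk'' hC'').IsMaximal :=
  h Y' E' _ (isMaximal_reslice h h𝒟 ι' ν' hι' hν' hh hk hC) Y'' E'' ι'' ν'' hι'' hν'' hh'' @hk'' hC''

end choquetBruhat_geroch_mghd_reslice

end Literature.Geometry.Lorentzian

end
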